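import Summits.FinalStateConjecture.FinalStateConjecture.Theses.ZeroEnergyKerrOrBomb
import Literature.Geometry.Lorentzian.KerrHyperboloidalLeaves
import Literature.Geometry.Lorentzian.ChartCalculus

/-!
# `ZeroEnergyRigidity` (stmt-FinalStateConjecture-10690, route ZeroEnergyKerrOrBomb) —
# negative-side lemma I: the Kerr parameter `a` of the conclusion is fixed at most up to sign

Tightness lemma for the CONCLUSION of the crux (`∃ (M a), |a| < M ∧ ∃ Ψ : Kerr.exterior M a → 𝓑,
injective, range = d.o.c., isometric immersion of `Kerr.smoothMetric M a r₊`):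

* `reflY` — the spatial reflection `(t*, x, y, z) ↦ (t*, x, −y, z)` of the Kerr–Schild chart `E4`;
  `radius_reflY`, `bilin_neg_reflY` — it preserves the Kerr–Schild radius and intertwines the
  Kerr–Schild forms of `(M, a)` and `(M, −a)`:
  `g_{M,−a}(Ry)(Rv, Rw) = g_{M,a}(y)(v, w)` (the components `ℓ₁, ℓ₂` of the null covector pick up
  exactly the signs the reflection produces; `r`, `H` depend on `a²` only);
* `reflExt M a : Kerr.exterior M (−a) → Kerr.exterior M a` — the induced bijection of exteriors
  (`r₊(M, −a) = r₊(M, a)`), smooth with differential `reflY`, an isometric immersion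
  (`isIsometricImmersion_reflExt`): **`Kerr(M, −a) ≅ Kerr(M, a)`** as smooth Lorentzian manifolds;
* `kerrExteriorPresentation_neg`, `exists_kerrExteriorPresentation_iff_nonneg` — consequently, for
  ANY `𝓑 : StationaryAFBlackHole`, the conclusion of `ZeroEnergyRigidity` / `KerrOrBomb` holds with
  parameters `(M, a)` iff it holds with `(M, −a)`, and is equivalent to its normalised form `0 ≤ a`:
  the existential over `a` carries a redundant sign, `∃!`-strengthenings of the conclusion are false
  for rotating holes, and a prover must fix the sign of `a` by an orientation convention.

No hypothesis of the crux is involved; nothing here asserts a Theses statement.  Refuter seat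
`refuter-cdisprove-stmt-FinalStateConjecture-10690-0` (cdisprove, cycle 1, 2026-08-16); workfile
`Cruxes/ZeroEnergyRigidity/Disproof.lean` § (b).

## References

* B. O'Neill, *The geometry of Kerr black holes*, A K Peters 1995, Ch. 2, §2.2 (the isometries
  `(t, φ) ↦ (−t, −φ)` and the equatorial/axial symmetries of the Kerr family; `a ↦ −a` reverses the
  sense of rotation).
* R. P. Kerr, A. Schild, Proc. Symp. Appl. Math. 17 (1965) 199 (`g = η + 2Hℓ⊗ℓ`).
-/

noncomputable section

namespace Summit.FinalStateConjecture.FinalStateConjecture.Theorems.ZeroEnergyRigidity.Negative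

open Set Literature.Geometry.Lorentzian
open scoped Manifold ContDiff Topology

/-! ### The reflection `y ↦ −y` of the Kerr–Schild chart -/

/-- The spatial reflection `(t*, x, y, z) ↦ (t*, x, −y, z)` of `E4`, as a linear map. [folklore] -/
def reflYLin : E4 →ₗ[ℝ] E4 where
  toFun x := WithLp.toLp 2 fun μ ↦ if μ = 2 then -(x μ) else x μ
  map_add' x y := by
    ext μ
    by_cases h : μ = 2 <;> simp [h] ; ring
  map_smul' c x := by
    ext μ
    by_cases h : μ = 2 <;> simp [h]

/-- The spatial reflection `(t*, x, y, z) ↦ (t*, x, −y, z)` of `E4`, as a continuous linear map.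
[folklore] -/
def reflY : E4 →L[ℝ] E4 := LinearMap.toContinuousLinearMap reflYLin

/-- Components of the reflection. [folklore] -/
@[simp] theorem reflY_apply (x : E4) (μ : Fin 4) :
    reflY x μ = if μ = 2 then -(x μ) else x μ := by
  simp [reflY, reflYLin]

/-- `(Rx)⁰ = x⁰`. [folklore] -/
theorem reflY_apply_zero (x : E4) : reflY x 0 = x 0 := by simp
/-- `(Rx)¹ = x¹`. [folklore] -/
theorem reflY_apply_one (x : E4) : reflY x 1 = x 1 := by simp
/-- `(Rx)² = −x²`. [folklore] -/
theorem reflY_apply_two (x : E4) : reflY x 2 = -(x 2) := by simp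
/-- `(Rx)³ = x³`. [folklore] -/
theorem reflY_apply_three (x : E4) : reflY x 3 = x 3 := by simp

/-- The reflection is an involution. [folklore] -/
theorem reflY_reflY (x : E4) : reflY (reflY x) = x := by
  ext μ
  by_cases h : μ = 2 <;> simp [h]

/-- The reflection preserves the spatial radius `‖x⃗‖`. [folklore] -/
theorem spatialNorm_reflY (x : E4) : E4.spatialNorm (reflY x) = E4.spatialNorm x := by
  have h1 : E4.spatialNorm (reflY x) ^ 2 = E4.spatialNorm x ^ 2 := by
    rw [E4.spatialNorm_sq, E4.spatialNorm_sq, reflY_apply_one, reflY_apply_two,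
      reflY_apply_three, neg_sq]
  exact (pow_left_inj₀ (E4.spatialNorm_nonneg _) (E4.spatialNorm_nonneg _) two_ne_zero).1 h1

/-- The Kerr–Schild radius depends on `a` only through `a²`: `r(−a, x) = r(a, x)`
(Visser arXiv:0706.0622, (35)). [folklore] -/
theorem radius_neg (a : ℝ) (x : E4) : Kerr.radius (-a) x = Kerr.radius a x := by
  unfold Kerr.radius
  rw [neg_sq]

/-- The Kerr–Schild radius is invariant under the reflection (it is a function of `‖x⃗‖` and
`z²`). [folklore] -/
theorem radius_reflY (a : ℝ) (x : E4) : Kerr.radius a (reflY x) = Kerr.radius a x := by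
  unfold Kerr.radius
  rw [spatialNorm_reflY, reflY_apply_three]

/-- `H_{M,−a}(Rx) = H_{M,a}(x)` for the Kerr–Schild scalar `H = Mr³/(r⁴ + a²z²)`. [folklore] -/
theorem scalarH_neg_reflY (M a : ℝ) (x : E4) :
    Kerr.scalarH M (-a) (reflY x) = Kerr.scalarH M a x := by
  unfold Kerr.scalarH
  rw [radius_neg, radius_reflY, reflY_apply_three, neg_sq]

/-- `ℓ_{−a}(Rx)(Rv) = ℓ_a(x)(v)` for the Kerr–Schild null covector
`ℓ = (1, (rx + ay)/(r² + a²), (ry − ax)/(r² + a²), z/r)`. [folklore] -/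
theorem nullCovector_neg_reflY (a : ℝ) (x v : E4) :
    Kerr.nullCovector (-a) (reflY x) (reflY v) = Kerr.nullCovector a x v := by
  simp only [Kerr.nullCovector, Kerr.nullCovectorFun, E4.covector_apply, Fin.sum_univ_four,
    radius_neg, radius_reflY, reflY_apply_zero, reflY_apply_one, reflY_apply_two,
    reflY_apply_three, Fin.isValue, Matrix.cons_val_zero, Matrix.cons_val_one, Matrix.cons_val]
  norm_num
  ring

/-- The reflection is a Minkowski isometry: `η(Rv, Rw) = η(v, w)`. [folklore] -/
theorem minkowski_reflY (v w : E4) :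
    Minkowski.bilin (reflY v) (reflY w) = Minkowski.bilin v w := by
  simp [Fin.sum_univ_three]

/-- **The reflection intertwines the Kerr–Schild forms of `(M, a)` and `(M, −a)`:**
`g_{M,−a}(Rx)(Rv, Rw) = g_{M,a}(x)(v, w)` (O'Neill 1995, Ch. 2, §2.2: `a ↦ −a` is undone by
reversing the sense of rotation). [folklore] -/
theorem bilin_neg_reflY (M a : ℝ) (x v w : E4) :
    Kerr.bilin M (-a) (reflY x) (reflY v) (reflY w) = Kerr.bilin M a x v w := by
  rw [Kerr.bilin_apply, Kerr.bilin_apply, minkowski_reflY, scalarH_neg_reflY,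
    nullCovector_neg_reflY, nullCovector_neg_reflY]

/-- `r₊(M, −a) = r₊(M, a)`. [folklore] -/
theorem rPlus_neg (M a : ℝ) : Kerr.rPlus M (-a) = Kerr.rPlus M a := by
  simp [Kerr.rPlus]

/-- `|−a| < M ↔ |a| < M`. [folklore] -/
theorem isSubextremal_neg_iff (M a : ℝ) : Kerr.IsSubextremal M (-a) ↔ Kerr.IsSubextremal M a := by
  simp [Kerr.IsSubextremal]

/-! ### The induced isometry of Kerr exteriors `(M, −a) → (M, a)` -/

/-- The reflection maps the `(M, −a)` exterior (typed as the chart `Kerr.region (−a) (r₊(M, −a))`,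
which is `Kerr.exterior M (−a)` by `rfl`) into the `(M, a)` exterior. [folklore] -/
theorem reflY_mem_exterior {M a : ℝ} {x : E4} (hx : x ∈ Kerr.region (-a) (Kerr.rPlus M (-a))) :
    reflY x ∈ Kerr.region a (Kerr.rPlus M a) := by
  rw [Kerr.mem_region] at hx ⊢
  rwa [rPlus_neg, radius_neg, ← radius_reflY] at hx

/-- The reflection as a map of Kerr exteriors `Kerr.exterior M (−a) → Kerr.exterior M a`
(chart-typed). [folklore] -/
def reflExt (M a : ℝ) : Kerr.region (-a) (Kerr.rPlus M (-a)) → Kerr.region a (Kerr.rPlus M a) :=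
  fun x ↦ ⟨reflY x.1, reflY_mem_exterior x.2⟩

/-- `reflExt` in coordinates. [folklore] -/
theorem coe_reflExt (M a : ℝ) (x : Kerr.region (-a) (Kerr.rPlus M (-a))) :
    (reflExt M a x : E4) = reflY x.1 := rfl

/-- `reflExt` is injective (the reflection is an involution). [folklore] -/
theorem reflExt_injective (M a : ℝ) : Function.Injective (reflExt M a) := by
  intro x y h
  apply Subtype.ext
  have := congrArg (fun z : Kerr.region a (Kerr.rPlus M a) ↦ reflY z.1) h
  simpa [coe_reflExt, reflY_reflY] using this

/-- `reflExt` is surjective (the reflection is an involution preserving `r`). [folklore] -/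
theorem reflExt_surjective (M a : ℝ) : Function.Surjective (reflExt M a) := by
  intro y
  have hy : reflY y.1 ∈ Kerr.region (-a) (Kerr.rPlus M (-a)) := by
    have h2 := y.2
    rw [Kerr.mem_region] at h2 ⊢
    rwa [rPlus_neg, radius_neg, radius_reflY]
  exact ⟨⟨reflY y.1, hy⟩, Subtype.ext (by simp [coe_reflExt, reflY_reflY])⟩

/-- `reflExt` is smooth (a linear map between open submanifolds of `E4`). [folklore] -/
theorem contMDiff_reflExt (M a : ℝ) : ContMDiff 𝓘(ℝ, E4) 𝓘(ℝ, E4) ∞ (reflExt M a) := by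
  rw [← ContMDiff.subtypeVal_comp_iff]
  exact reflY.contMDiff.comp contMDiff_subtype_val

/-- The differential of `reflExt` is the reflection `reflY` (charts of open submanifolds are
restrictions of the identity: `OpensChart.mfderiv_codRestrict`, `OpensChart.mfderiv_eq`). [folklore] -/
theorem mfderiv_reflExt (M a : ℝ) (x : Kerr.region (-a) (Kerr.rPlus M (-a))) :
    mfderiv 𝓘(ℝ, E4) 𝓘(ℝ, E4) (reflExt M a) x = reflY := by
  have hf : ∀ y : Kerr.region (-a) (Kerr.rPlus M (-a)),
      (fun y : Kerr.region (-a) (Kerr.rPlus M (-a)) ↦ reflY y.1) y = reflY y.1 := fun _ ↦ rfl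
  have hd : MDifferentiableAt 𝓘(ℝ, E4) 𝓘(ℝ, E4)
      (fun y : Kerr.region (-a) (Kerr.rPlus M (-a)) ↦ reflY y.1) x :=
    (OpensChart.mdifferentiableAt_iff x _ reflY hf).2 reflY.differentiableAt
  rw [OpensChart.mfderiv_codRestrict (φ := reflExt M a)
    (f := fun y : Kerr.region (-a) (Kerr.rPlus M (-a)) ↦ reflY y.1) (fun _ ↦ rfl) hd,
    OpensChart.mfderiv_eq x _ reflY hf reflY.differentiableAt, ContinuousLinearMap.fderiv]

/-- **`Kerr(M, −a) ≅ Kerr(M, a)`**: the reflection is an isometric immersion (indeed a bijective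
one, `reflExt_injective`/`reflExt_surjective`) of the smooth Kerr exterior `(M, −a)` onto the smooth
Kerr exterior `(M, a)` in ingoing Kerr–Schild coordinates.  O'Neill 1995, Ch. 2, §2.2. [folklore] -/
theorem isIsometricImmersion_reflExt [Kerr.Facts] (M a : ℝ) :
    PseudoRiemannianMetric.IsIsometricImmersion
      (Kerr.smoothMetric M (-a) (Kerr.rPlus M (-a))).toPseudoRiemannianMetric
      (Kerr.smoothMetric M a (Kerr.rPlus M a)).toPseudoRiemannianMetric (reflExt M a) := by
  refine ⟨contMDiff_reflExt M a, fun y ↦ ?_⟩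
  ext v w
  rw [pullbackBilin_apply, mfderiv_reflExt]
  change Kerr.bilin M a (reflY y.1) (reflY v) (reflY w) = Kerr.bilin M (-a) y.1 v w
  have := bilin_neg_reflY M (-a) y.1 v w
  rwa [neg_neg] at this

/-! ### Consequence for the conclusion of the crux -/

/-- **The d.o.c. of `𝓑` is presented by the Kerr exterior `(M, a)`**: the `∃ Ψ`-clause of the
conclusion of `ZeroEnergyRigidity` / `KerrOrBomb` at fixed parameters (chart-typed domain
`Kerr.region a (r₊(M, a))` = `Kerr.exterior M a` by `rfl`, cf. `kerrExteriorPresentation_iff`).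
[folklore] -/
def KerrExteriorPresentation (𝓑 : StationaryAFBlackHole.{0}) [Kerr.Facts] (M a : ℝ) : Prop :=
  ∃ Ψ : Kerr.region a (Kerr.rPlus M a) → 𝓑.carrier, Function.Injective Ψ ∧ Set.range Ψ = 𝓑.doc ∧
    PseudoRiemannianMetric.IsIsometricImmersion
      (Kerr.smoothMetric M a (Kerr.rPlus M a)).toPseudoRiemannianMetric
      𝓑.metric.toPseudoRiemannianMetric Ψ

/-- `KerrExteriorPresentation` in the exterior-typed spelling of the crux (`Iff.rfl`). [folklore] -/
theorem kerrExteriorPresentation_iff (𝓑 : StationaryAFBlackHole.{0}) [Kerr.Facts] (M a : ℝ) :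
    KerrExteriorPresentation 𝓑 M a ↔
      ∃ Ψ : Kerr.exterior M a → 𝓑.carrier, Function.Injective Ψ ∧ Set.range Ψ = 𝓑.doc ∧
        PseudoRiemannianMetric.IsIsometricImmersion
          (Kerr.smoothMetric M a (Kerr.rPlus M a)).toPseudoRiemannianMetric
          𝓑.metric.toPseudoRiemannianMetric Ψ :=
  Iff.rfl

/-- **Tightness: the rotation parameter of the conclusion is determined at most up to sign.** If the
d.o.c. of `𝓑` is presented by the Kerr exterior `(M, a)` it is presented by the Kerr exterior
`(M, −a)` (precompose `Ψ` with the isometry `reflExt`; functoriality of the pullback,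
`pullbackBilin_comp`). [folklore] -/
theorem kerrExteriorPresentation_neg (𝓑 : StationaryAFBlackHole.{0}) [Kerr.Facts] {M a : ℝ}
    (h : KerrExteriorPresentation 𝓑 M a) : KerrExteriorPresentation 𝓑 M (-a) := by
  obtain ⟨Ψ, hinj, hrange, hsmooth, hpull⟩ := h
  have hΨd : MDifferentiable 𝓘(ℝ, E4) (𝓡 4) Ψ := hsmooth.mdifferentiable (by simp)
  have hφd : MDifferentiable 𝓘(ℝ, E4) 𝓘(ℝ, E4) (reflExt M a) :=
    (contMDiff_reflExt M a).mdifferentiable (by simp)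
  refine ⟨Ψ ∘ reflExt M a, hinj.comp (reflExt_injective M a), ?_,
    hsmooth.comp (contMDiff_reflExt M a), fun y ↦ ?_⟩
  · rw [Set.range_comp, (reflExt_surjective M a).range_eq, Set.image_univ, hrange]
  · rw [pullbackBilin_comp hΨd hφd, funext hpull]
    exact (isIsometricImmersion_reflExt M a).2 y

/-- `(M, a)` presents the d.o.c. iff `(M, −a)` does. [folklore] -/
theorem kerrExteriorPresentation_neg_iff (𝓑 : StationaryAFBlackHole.{0}) [Kerr.Facts] (M a : ℝ) :
    KerrExteriorPresentation 𝓑 M (-a) ↔ KerrExteriorPresentation 𝓑 M a :=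
  ⟨fun h ↦ by simpa using kerrExteriorPresentation_neg 𝓑 h, kerrExteriorPresentation_neg 𝓑⟩

/-- **Normal form of the conclusion of `ZeroEnergyRigidity` / `KerrOrBomb`.** The conclusion
`∃ (M a), |a| < M ∧ (∃ Ψ …)` is equivalent to the same statement with `0 ≤ a`: the sign of `a` in the
existential is redundant (so an `∃!`-strengthening is false for every rotating presentation, and a
proof must fix the sign by an orientation convention). [folklore] -/
theorem exists_kerrExteriorPresentation_iff_nonneg (𝓑 : StationaryAFBlackHole.{0}) [Kerr.Facts] :
    (∃ M a : ℝ, Kerr.IsSubextremal M a ∧ KerrExteriorPresentation 𝓑 M a) ↔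
      ∃ M a : ℝ, Kerr.IsSubextremal M a ∧ 0 ≤ a ∧ KerrExteriorPresentation 𝓑 M a := by
  constructor
  · rintro ⟨M, a, hMa, h⟩
    rcases le_total 0 a with ha | ha
    · exact ⟨M, a, hMa, ha, h⟩
    · exact ⟨M, -a, (isSubextremal_neg_iff M a).2 hMa, neg_nonneg.2 ha,
        kerrExteriorPresentation_neg 𝓑 h⟩
  · rintro ⟨M, a, hMa, -, h⟩
    exact ⟨M, a, hMa, h⟩

end Summit.FinalStateConjecture.FinalStateConjecture.Theorems.ZeroEnergyRigidity.Negative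

end
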